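import Literature.MathematicalPhysics.QuantumFieldTheory.BorinskyMunchTellander2023.SecondSymanzikUVFace
import HarnessLib

/-!
# The initial form of `ℱ_G(𝒫)` on the IR face `−1_γ` of a mass-momentum spanning `γ` is `ℱ_γ(𝒫) · 𝒰_{G/γ}` — Brown 2017 Prop. 2.4 / Thm 2.7 (IR line) for Gram-matrix kinematics in EVERY regime, at the level of monomials — PROVED

**Sources.** F. Brown, arXiv:1512.06409 [cite: Brown2017] — Proposition 2.4 ("Φ_G(q) = Φ_γ(q)Ψ_{G/γ} + R^{Φ,IR}_{γ,G}(q) where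
R^{Φ,IR}_{γ,G}(q) is of degree > h_γ + 1 in the variables α_e, e ∈ E_γ") and Theorem 2.7, second line ("Now suppose that γ is a
mass-momentum subgraph. In this case, Ξ_G(q,m) = Ξ_γ(q,m) Ψ_{G/γ} + R^{Ξ,IR}_{γ,G}(q,m) where R^{Ξ,IR}_{γ,G}(q,m) has degree > h_γ+1
in the α_e, e ∈ E_γ"), with the proof of Prop. 2.4 (the classes `C_1`, `C_2` of 2-trees and the bijection `T ↦ (T ∩ γ', (T ∪ γ)/γ,
T ∩ γ_i)`). K. Schultka, arXiv:1806.01086 [cite: Schultka2018] — Proposition 4.11 (1),(4),(5) and Corollary 4.12 ("F_{e^γ}P_G = P_γ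
× P_{G/γ}"). M. Borinsky 2020 [cite: Borinsky2020] — Definition 1 (truncation) and the proof of Theorem 32 (`z_Φ(γ) = ℓ(γ) + 1`
for m.m. `γ` "follows directly from the factorization laws"). M. Borinsky, H. J. Munch, F. Tellander, CPC 292 (2023) 108874 =
arXiv:2302.08955 [cite: BorinskyMunchTellander2023] — §2.1 eq. (polyUF) and §2.2 (`ℱ` from a symmetric `𝒫` with vanishing row
sums, every regime), §3.3 (m.m. subgraphs), Theorem 3.5.

**What is typed here (all PROVED; 0 named facts).** The companion `SecondSymanzikUVFace.lean` typed the UV line of Theorem 2.7 for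
`𝒫`-kinematics; `SecondSymanzikFactorization.lean` typed both lines for Euclidean VECTOR momenta. This file types the **IR LINE FOR
`𝒫`-KINEMATICS IN EVERY REGIME** (Minkowski included; no genericity) at the level of monomials. With `ℱ_γ(𝒫) :=
gramSecondSymanzikSub E γ P m a` (Part 2: the subgraph's second Symanzik polynomial with the kinematics of `G`, its 2-forest
coefficients `−Σ_{u,v ∈ V'} 𝒫^{u,v}` read over the side `V'` of a vertex `a`, masses of `γ`) and `γ` MASS-MOMENTUM SPANNING in the
combinatorial sense (`IsMassMomentumSpanningGram`: every massive edge in `γ`, all external vertices joined by `γ`), `a` reaching the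
external vertices inside `γ`: (1) every monomial of `ℱ_γ(𝒫) · Ψ_{G/γ}` has exactly `L_γ + 1` variables of `γ`
(`gammaDeg_of_mem_support_sub_mul_quot`); (2) at every exponent with exactly `L_γ + 1` variables of `γ` the coefficients of
`ℱ_G(𝒫)` and `ℱ_γ(𝒫) · Ψ_{G/γ}` AGREE (`coeff_eq_coeff_sub_mul_of_gammaDeg_eq` — Brown's classes: `C_1` 2-forests
(`coeff_twoForest_eq_coeff_sub_mul_of_indep`, through the squared-momentum transfer `sqMomentum_rootSide_eq_of_contract_indep` and
the cut transfer `sum_cutEdges_eq_sum_subCutEdges`), `C_2` 2-forests (both sides `0`: `coeff_twoForest_eq_coeff_sub_mul_of_not_indep`),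
and the two kinds of mass monomials (`coeff_tree_add_single_eq_coeff_sub_mul`, `…_of_notMem`)); hence, with the companion's
"every monomial of `ℱ_G(𝒫)` has `≥ L_γ + 1` variables of `γ` when `ℱ_{G/γ}(𝒫) = 0`", (3) **`le_gammaDeg_of_mem_support_ir_remainder_gram`**:
every monomial of `ℱ_G(𝒫) − ℱ_γ(𝒫) · Ψ_{G/γ}` has `≥ L_γ + 2` variables of `γ` — Brown's "R^{Ξ,IR} has degree > h_γ+1"; and (4)
**`faceValue_and_trunc_gramSecondSymanzik_neg_setIndicator_of_mm`**: Borinsky's truncation of `ℱ_G(𝒫)` to the face exposed by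
`−1_γ` is the PRODUCT `ℱ_γ(𝒫) · Ψ_{G/γ}` with face value `−(L_γ + 1)`, whenever `ℱ_γ(𝒫) ≠ 0`.

**Route (disclosed).** Brown's proof of Prop. 2.4, run at the level of coefficients exactly as the companion runs Lemma 2.1 for the
UV line: the monomials of `ℱ_G(𝒫)` are 2-forest or (tree, edge) monomials (`support_gramSecondSymanzik_subset`); those of
`ℱ_γ(𝒫) · Ψ_{G/γ}` (separated variables) reassemble into class-`C_1` 2-forests `F' ∪ B'` (`isSpanningTwoForest_union_of_sub`) or
mass monomials over trees `B ∪ B'` (`isSpanningTree_union`). The geometric inputs are the `𝒫`-forms of the companion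
`SecondSymanzikFactorization`'s flow lemmas: inside the momentum component the components of a `C_1` 2-forest `S` are those of
`S ∩ γ` (strict submodularity `edgeRank_union_add_inter_add_one_le`), and `Σ_{u,v∈V'} 𝒫^{u,v}` depends only on the external
vertices of `V'` and is complement-invariant (`sqMomentum_eq_filter_isExternal`, `sqMomentum_compl`). READINGS: `𝒫` with the two
printed hypotheses (symmetric, vanishing row sums); m.m. in the combinatorial sense via `IsExternal` (for generic kinematics this is
`ℱ_{G/γ}(𝒫) = 0`, companion `isMassMomentumSpanningGram_iff_gramSecondSymanzikQuot_eq_zero`); `ℱ_γ` read from a vertex `a` as in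
the companion (for `γ = γ_0 ∪ γ_1 ∪ ⋯` it IS Brown's `Ξ_{γ_0} Π Ψ_{γ_i}` plus terms with coefficient `0`). NOT typed: an explicit
remainder FORMULA; the quotient GRAPH. D-0026: no new fact; plumbing duplicated from the companions.
-/

noncomputable section

namespace Literature.MathematicalPhysics.QuantumFieldTheory.BorinskyMunchTellander2023

open Finset MvPolynomial Matrix Matroid
open Literature.MathematicalPhysics.QuantumFieldTheory
open Literature.MathematicalPhysics.QuantumFieldTheory.Borinsky2020

variable {N V : ℕ} {E : Fin N → Fin (V + 1) × Fin (V + 1)}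

/-! ## Part 1 — plumbing (exponent vectors inside an ambient edge set `A`; products in disjoint variables) -/

section Plumbing

/-- `(Σ_{e'∈S} 𝟙_{e'})(k) = [k ∈ S]`. Plumbing. [folklore] -/
private theorem sum_single_apply (S : Finset (Fin N)) (k : Fin N) :
    (∑ e' ∈ S, Finsupp.single e' (1 : ℕ) : Fin N →₀ ℕ) k = if k ∈ S then 1 else 0 := by
  classical
  rw [Finsupp.coe_finsetSum, Finset.sum_apply]
  simp [Finsupp.single_apply]

/-- The support of `Σ_{e∈S} 𝟙_e` is `S`. Plumbing. [folklore] -/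
private theorem support_sum_single (S : Finset (Fin N)) :
    (∑ e' ∈ S, Finsupp.single e' (1 : ℕ) : Fin N →₀ ℕ).support = S := by
  classical
  ext k
  rw [Finsupp.mem_support_iff, sum_single_apply]
  simp

/-- `S ↦ Σ_{e∈S} 𝟙_e` is injective. Plumbing. [folklore] -/
private theorem sum_single_injective {S T : Finset (Fin N)}
    (h : (∑ e' ∈ S, Finsupp.single e' (1 : ℕ) : Fin N →₀ ℕ) = ∑ e' ∈ T, Finsupp.single e' 1) : S = T := by
  have := congrArg Finsupp.support h
  rwa [support_sum_single, support_sum_single] at this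

/-- Inside `A`: `𝟙_{A∖B} + 𝟙_e = 𝟙_{A∖F}` iff `e ∉ F` and `B = F + e` (`B, F ⊆ A`, `e ∈ A`). Plumbing. [folklore] -/
private theorem sdiff_add_single_eq_iff {A B F : Finset (Fin N)} {e : Fin N} (hB : B ⊆ A) (hF : F ⊆ A) (he : e ∈ A) :
    ∑ e' ∈ A \ B, Finsupp.single e' (1 : ℕ) + Finsupp.single e 1 = ∑ e' ∈ A \ F, Finsupp.single e' 1 ↔
      e ∉ F ∧ B = insert e F := by
  classical
  constructor
  · intro h
    have hk : ∀ k, (if k ∈ A \ B then 1 else 0) + (if e = k then 1 else 0) = (if k ∈ A \ F then (1 : ℕ) else 0) := by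
      intro k
      have := DFunLike.congr_fun h k
      rwa [Finsupp.add_apply, sum_single_apply, sum_single_apply, Finsupp.single_apply] at this
    have hke := hk e
    rw [if_pos rfl] at hke
    have heB : e ∈ B := by
      by_contra heB
      rw [if_pos (Finset.mem_sdiff.2 ⟨he, heB⟩)] at hke
      by_cases h' : e ∈ A \ F
      · rw [if_pos h'] at hke; omega
      · rw [if_neg h'] at hke; omega
    have heF : e ∉ F := by
      intro heF
      rw [if_neg (fun h => (Finset.mem_sdiff.1 h).2 heF)] at hke
      by_cases h' : e ∈ A \ B
      · rw [if_pos h'] at hke; omega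
      · rw [if_neg h'] at hke; omega
    refine ⟨heF, ?_⟩
    ext k
    rw [Finset.mem_insert]
    by_cases hke' : k = e
    · subst hke'
      simp [heB]
    · have h' := hk k
      rw [if_neg (Ne.symm hke'), add_zero] at h'
      constructor
      · intro hkB
        right
        by_contra hkF
        rw [if_neg (fun h => (Finset.mem_sdiff.1 h).2 hkB), if_pos (Finset.mem_sdiff.2 ⟨hB hkB, hkF⟩)] at h'
        omega
      · rintro (h1 | hkF)
        · exact absurd h1 hke'
        · by_contra hkB
          rw [if_pos (Finset.mem_sdiff.2 ⟨hF hkF, hkB⟩), if_neg (fun h => (Finset.mem_sdiff.1 h).2 hkF)] at h'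
          omega
  · rintro ⟨heF, rfl⟩
    ext k
    rw [Finsupp.add_apply, sum_single_apply, sum_single_apply, Finsupp.single_apply]
    by_cases hke' : e = k
    · subst hke'
      rw [if_neg (fun h => (Finset.mem_sdiff.1 h).2 (Finset.mem_insert_self e F)), if_pos rfl,
        if_pos (Finset.mem_sdiff.2 ⟨he, heF⟩)]
    · rw [if_neg hke', add_zero]
      have : k ∈ A \ insert e F ↔ k ∈ A \ F := by
        rw [Finset.mem_sdiff, Finset.mem_sdiff, Finset.mem_insert, not_or]
        exact ⟨fun h => ⟨h.1, h.2.2⟩, fun h => ⟨h.1, fun h' => hke' h'.symm, h.2⟩⟩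
      by_cases hk : k ∈ A \ F
      · rw [if_pos (this.2 hk), if_pos hk]
      · rw [if_neg (fun h => hk (this.1 h)), if_neg hk]

/-- Inside `A`: the non-square-free exponent `𝟙_{A∖B} + 𝟙_e` (`e ∉ B`) determines `(B, e)`. Plumbing. [folklore] -/
private theorem sdiff_add_single_inj {A B B' : Finset (Fin N)} {e e' : Fin N} (hB : B ⊆ A) (hB' : B' ⊆ A) (he : e ∈ A)
    (heB : e ∉ B)
    (h : ∑ x ∈ A \ B', Finsupp.single x (1 : ℕ) + Finsupp.single e' 1 = ∑ x ∈ A \ B, Finsupp.single x 1 + Finsupp.single e 1) :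
    B' = B ∧ e' = e := by
  classical
  have hk : ∀ k, (if k ∈ A \ B' then 1 else 0) + (if e' = k then 1 else 0) =
      (if k ∈ A \ B then (1 : ℕ) else 0) + (if e = k then 1 else 0) := by
    intro k
    have := DFunLike.congr_fun h k
    rwa [Finsupp.add_apply, Finsupp.add_apply, sum_single_apply, sum_single_apply, Finsupp.single_apply,
      Finsupp.single_apply] at this
  have hee : e' = e := by
    have hke := hk e
    rw [if_pos (Finset.mem_sdiff.2 ⟨he, heB⟩), if_pos rfl] at hke
    by_contra hne
    rw [if_neg hne] at hke
    by_cases h' : e ∈ A \ B'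
    · rw [if_pos h'] at hke; omega
    · rw [if_neg h'] at hke; omega
  subst hee
  refine ⟨?_, rfl⟩
  ext k
  have h' := hk k
  have h'' : (if k ∈ A \ B' then 1 else 0) = (if k ∈ A \ B then (1 : ℕ) else 0) := by omega
  by_cases hk1 : k ∈ A \ B' <;> by_cases hk2 : k ∈ A \ B
  · rw [Finset.mem_sdiff] at hk1 hk2
    exact ⟨fun h => absurd h hk1.2, fun h => absurd h hk2.2⟩
  · rw [if_pos hk1, if_neg hk2] at h''; omega
  · rw [if_neg hk1, if_pos hk2] at h''; omega
  · rw [Finset.mem_sdiff, not_and, not_not] at hk1 hk2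
    by_cases hkA : k ∈ A
    · exact ⟨fun _ => hk2 hkA, fun _ => hk1 hkA⟩
    · exact ⟨fun h => absurd (hB' h) hkA, fun h => absurd (hB h) hkA⟩

/-- Inside `A`: a square-free exponent is never `𝟙_{A∖B} + 𝟙_e` with `e ∈ A∖B`. Plumbing. [folklore] -/
private theorem sdiff_ne_sdiff_add_single {A B F : Finset (Fin N)} {e : Fin N} (he : e ∈ A) (heB : e ∉ B) :
    ∑ x ∈ A \ F, Finsupp.single x (1 : ℕ) ≠ ∑ x ∈ A \ B, Finsupp.single x 1 + Finsupp.single e 1 := by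
  classical
  intro h
  have := DFunLike.congr_fun h e
  rw [Finsupp.add_apply, sum_single_apply, sum_single_apply, Finsupp.single_apply, if_pos rfl,
    if_pos (Finset.mem_sdiff.2 ⟨he, heB⟩)] at this
  by_cases h' : e ∈ A \ F
  · rw [if_pos h'] at this; omega
  · rw [if_neg h'] at this; omega

/-- `deg_γ x^{𝟙_{E∖F}} = |γ ∖ F|`. Plumbing. [folklore] -/
private theorem gammaDeg_compl (F γ : Finset (Fin N)) :
    ∑ e ∈ γ, (∑ e' ∈ Fᶜ, Finsupp.single e' (1 : ℕ) : Fin N →₀ ℕ) e = (γ \ F).card := by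
  rw [gammaDeg_sum_single, ← Finset.sdiff_eq_inter_compl]

/-- `deg_γ x^{𝟙_{E∖T} + 𝟙_e} = |γ ∖ T| + [e ∈ γ]`. Plumbing. [folklore] -/
private theorem gammaDeg_compl_add_single (T γ : Finset (Fin N)) (e : Fin N) :
    ∑ x ∈ γ, (∑ e' ∈ Tᶜ, Finsupp.single e' (1 : ℕ) + Finsupp.single e 1 : Fin N →₀ ℕ) x =
      (γ \ T).card + if e ∈ γ then 1 else 0 := by
  classical
  simp only [Finsupp.add_apply, Finset.sum_add_distrib]
  rw [gammaDeg_compl]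
  congr 1
  simp only [Finsupp.single_apply]
  rw [Finset.sum_ite_eq]

/-- The square-free exponent of the mass monomial `(T, e)` with `e ∈ T` is that of the 2-forest `T − e`. Plumbing. [folklore] -/
private theorem sum_single_compl_add_single_of_mem {T : Finset (Fin N)} {e : Fin N} (he : e ∈ T) :
    ∑ e' ∈ Tᶜ, Finsupp.single e' (1 : ℕ) + Finsupp.single e 1 = ∑ e' ∈ (T.erase e)ᶜ, Finsupp.single e' 1 := by
  classical
  rw [Finset.compl_erase, Finset.sum_insert (fun h => (Finset.mem_compl.1 h) he), add_comm]

/-- `𝟙_{E∖F} = 𝟙_{γ∖(F∩γ)} + 𝟙_{(E∖γ)∖(F∖γ)}`. Plumbing. [folklore] -/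
private theorem sum_single_compl_eq_add (F γ : Finset (Fin N)) :
    ∑ e' ∈ Fᶜ, Finsupp.single e' (1 : ℕ) =
      ∑ e' ∈ γ \ (F ∩ γ), Finsupp.single e' 1 + ∑ e' ∈ γᶜ \ (F \ γ), Finsupp.single e' 1 := by
  classical
  rw [← Finset.sum_union
    (Finset.disjoint_left.2 fun e h1 h2 => (Finset.mem_compl.1 (Finset.mem_sdiff.1 h2).1) (Finset.mem_sdiff.1 h1).1)]
  congr 1
  ext e
  simp only [Finset.mem_compl, Finset.mem_union, Finset.mem_sdiff, Finset.mem_inter]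
  by_cases heγ : e ∈ γ <;> by_cases heF : e ∈ F <;> simp [heγ, heF]

/-- Coefficients of a product of polynomials in disjoint sets of variables (as in the companion). Plumbing. [folklore] -/
private theorem coeff_add_mul_of_separated {γ : Finset (Fin N)} {P Q : MvPolynomial (Fin N) ℝ}
    (hP : ∀ a ∈ P.support, ∀ e ∉ γ, a e = 0) (hQ : ∀ b ∈ Q.support, ∀ e ∈ γ, b e = 0)
    {a b : Fin N →₀ ℕ} (ha : ∀ e ∉ γ, a e = 0) (hb : ∀ e ∈ γ, b e = 0) :
    coeff (a + b) (P * Q) = coeff a P * coeff b Q := by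
  classical
  rw [coeff_mul]
  refine Finset.sum_eq_single (a, b) (fun x hx hne => ?_) (fun h => (h ?_).elim)
  swap
  · rw [Finset.HasAntidiagonal.mem_antidiagonal]
  by_contra hprod
  have h1 : coeff x.1 P ≠ 0 := fun h => hprod (by rw [h, zero_mul])
  have h2 : coeff x.2 Q ≠ 0 := fun h => hprod (by rw [h, mul_zero])
  have hx' := Finset.HasAntidiagonal.mem_antidiagonal.1 hx
  have hxa : x.1 = a := by
    ext e
    have := DFunLike.congr_fun hx' e
    rw [Finsupp.add_apply, Finsupp.add_apply] at this
    by_cases he : e ∈ γ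
    · rw [hQ x.2 (mem_support_iff.2 h2) e he, hb e he] at this
      simpa using this
    · rw [hP x.1 (mem_support_iff.2 h1) e he, ha e he]
  have hxb : x.2 = b := by
    have := hx'
    rw [hxa] at this
    exact add_left_cancel this
  exact hne (Prod.ext hxa hxb)

/-- A square-free product of variables is a monomial. Plumbing. [folklore] -/
private theorem prod_X_eq_monomial (S : Finset (Fin N)) :
    ∏ e ∈ S, (X e : MvPolynomial (Fin N) ℝ) = monomial (∑ e' ∈ S, Finsupp.single e' 1) 1 := by
  classical
  induction S using Finset.induction_on with
  | empty => simp
  | insert e S he ih =>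
    rw [Finset.prod_insert he, Finset.sum_insert he, ih, ← pow_one (X e), X_pow_eq_monomial, monomial_mul, one_mul]

end Plumbing

/-! ## Part 2 — `ℱ_γ(𝒫)`: the subgraph's second Symanzik polynomial with the kinematics of `G`, read off `𝒫` from a vertex `a`; its monomials; the monomials of `Ψ_{G/γ}` -/

section SubPolynomial

variable (E)

open scoped Classical in
/-- **`ℱ_γ`, the second Symanzik polynomial of the edge SUBGRAPH `γ` WITH THE KINEMATICS OF `G`, read off `𝒫`** — the `𝒫`-form of
the companion's `Ξ_γ(q,m)` (`secondSymanzikSub`; Brown: "the Feynman graph (V_γ, E_γ, E^ext_γ) inherits all external momenta of G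
if it is momentum-spanning"; Schultka: "For an m.m. subgraph γ, we set V^ext_γ = V^ext_G and E^M_γ = E^M_G"): one term per spanning
2-forest `F'` of the subgraph `γ` (independent `F' ⊆ γ` with `|F'| = rk γ − 1`) with coefficient `−Σ_{u,v ∈ V'} 𝒫^{u,v}` over the
side `V' = {v : v ~_{F'} a}` of the vertex `a`, plus `Ψ_γ · Σ_{e∈γ} m_e² x_e`. Used below only under "every external vertex is
reached from `a` inside `γ`". [cite: Brown2017, §1.4 and Prop. 2.4 / Thm 2.7 eq. (XiIRfact); Schultka2018, §4 before Proposition 4.11 (toricfeynman.tex l.2205–2212); BorinskyMunchTellander2023, §2.1 eq. (polyUF)] -/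
def gramSecondSymanzikSub (γ : Finset (Fin N)) (P : Matrix (Fin (V + 1)) (Fin (V + 1)) ℝ) (m : Fin N → ℝ)
    (a : Fin (V + 1)) : MvPolynomial (Fin N) ℝ :=
  (∑ F' ∈ γ.powerset.filter (fun F' : Finset (Fin N) => edgeRank E F' = F'.card ∧ F'.card + 1 = edgeRank E γ),
      (-sqMomentum P (univ.filter fun v => (edgeGraph E F').Reachable a v)) • ∏ e ∈ γ \ F', X e) +
    kirchhoffSub E γ * ∑ e ∈ γ, m e ^ 2 • X e

open scoped Classical in
/-- The cut of a spanning 2-forest `F'` of the subgraph `γ` INSIDE `γ`: the edges `e ∈ γ ∖ F'` with `F' + e` a maximal forest of `γ`.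
[cite: Brown2017, Prop. 2.4 (proof); Schultka2018, Proposition 4.11 proof sketch (toricfeynman.tex l.2294–2304)] -/
def subCutEdges (γ F' : Finset (Fin N)) : Finset (Fin N) :=
  γ.filter fun e => e ∉ F' ∧ (cycleMatroid E).IsBasis (↑(insert e F') : Set (Fin N)) (↑γ : Set (Fin N))

variable {E}

open scoped Classical in
/-- The coefficients of `ℱ_γ(𝒫)`. [cite: Brown2017, Prop. 2.4 / Thm 2.7 eq. (XiIRfact); BorinskyMunchTellander2023, §2.1 eq. (polyUF)] -/
theorem coeff_gramSecondSymanzikSub (γ : Finset (Fin N)) (P : Matrix (Fin (V + 1)) (Fin (V + 1)) ℝ) (m : Fin N → ℝ)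
    (a : Fin (V + 1)) (d : Fin N →₀ ℕ) :
    coeff d (gramSecondSymanzikSub E γ P m a) =
      (∑ F' ∈ γ.powerset.filter (fun F' : Finset (Fin N) => edgeRank E F' = F'.card ∧ F'.card + 1 = edgeRank E γ),
          if ∑ e' ∈ γ \ F', Finsupp.single e' 1 = d then
            -sqMomentum P (univ.filter fun v => (edgeGraph E F').Reachable a v) else 0) +
        ∑ B ∈ γ.powerset.filter
            (fun B : Finset (Fin N) => (cycleMatroid E).IsBasis (↑B : Set (Fin N)) (↑γ : Set (Fin N))),
          ∑ e ∈ γ, if ∑ e' ∈ γ \ B, Finsupp.single e' 1 + Finsupp.single e 1 = d then m e ^ 2 else 0 := by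
  unfold gramSecondSymanzikSub kirchhoffSub
  rw [coeff_add, coeff_sum, Finset.sum_mul, coeff_sum]
  congr 1
  · refine Finset.sum_congr rfl fun F' _ => ?_
    rw [prod_X_eq_monomial, coeff_smul, coeff_monomial, smul_eq_mul, mul_ite, mul_one, mul_zero]
  · refine Finset.sum_congr rfl fun B _ => ?_
    rw [prod_X_eq_monomial, Finset.mul_sum, coeff_sum]
    refine Finset.sum_congr rfl fun e _ => ?_
    rw [mul_smul_comm, ← pow_one (X e), X_pow_eq_monomial, monomial_mul, one_mul, coeff_smul, coeff_monomial, smul_eq_mul,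
      mul_ite, mul_one, mul_zero]

open scoped Classical in
/-- **The coefficient of `x^{𝟙_{γ∖F'}}` in `ℱ_γ(𝒫)`** for a spanning 2-forest `F'` of `γ`: `−Σ_{u,v ~_{F'} a} 𝒫^{u,v} + Σ_{e ∈ cut_γ(F')} m_e²`.
[cite: Brown2017, Prop. 2.4 (proof); BorinskyMunchTellander2023, §2.1 eq. (polyUF)] -/
theorem coeff_gramSecondSymanzikSub_twoForest (γ : Finset (Fin N)) (P : Matrix (Fin (V + 1)) (Fin (V + 1)) ℝ) (m : Fin N → ℝ)
    (a : Fin (V + 1)) {F' : Finset (Fin N)} (hF'γ : F' ⊆ γ) (hF' : edgeRank E F' = F'.card ∧ F'.card + 1 = edgeRank E γ) :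
    coeff (∑ e' ∈ γ \ F', Finsupp.single e' 1) (gramSecondSymanzikSub E γ P m a) =
      -sqMomentum P (univ.filter fun v => (edgeGraph E F').Reachable a v) + ∑ e ∈ subCutEdges E γ F', m e ^ 2 := by
  rw [coeff_gramSecondSymanzikSub]
  congr 1
  · have h1 : ∀ F'' ∈ γ.powerset.filter (fun F' : Finset (Fin N) => edgeRank E F' = F'.card ∧ F'.card + 1 = edgeRank E γ),
        (if ∑ e' ∈ γ \ F'', Finsupp.single e' 1 = ∑ e' ∈ γ \ F', Finsupp.single e' (1 : ℕ) then
          -sqMomentum P (univ.filter fun v => (edgeGraph E F'').Reachable a v) else 0) =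
          if F'' = F' then -sqMomentum P (univ.filter fun v => (edgeGraph E F'').Reachable a v) else 0 := fun F'' hF'' => by
      have hF''γ : F'' ⊆ γ := Finset.mem_powerset.1 (Finset.mem_filter.1 hF'').1
      by_cases hFF : F'' = F'
      · rw [if_pos hFF, if_pos (by rw [hFF])]
      · rw [if_neg hFF, if_neg fun h => hFF ?_]
        have := sum_single_injective h
        rw [← Finset.sdiff_sdiff_eq_self hF''γ, this, Finset.sdiff_sdiff_eq_self hF'γ]
    rw [Finset.sum_congr rfl h1, Finset.sum_ite_eq', if_pos (Finset.mem_filter.2 ⟨Finset.mem_powerset.2 hF'γ, hF'⟩)]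
  · rw [Finset.sum_comm]
    unfold subCutEdges
    rw [Finset.sum_filter]
    refine Finset.sum_congr rfl fun e he => ?_
    by_cases hcut : e ∉ F' ∧ (cycleMatroid E).IsBasis (↑(insert e F') : Set (Fin N)) (↑γ : Set (Fin N))
    · rw [if_pos hcut]
      have hmem : insert e F' ∈ γ.powerset.filter
          (fun B : Finset (Fin N) => (cycleMatroid E).IsBasis (↑B : Set (Fin N)) (↑γ : Set (Fin N))) :=
        Finset.mem_filter.2 ⟨Finset.mem_powerset.2 (Finset.insert_subset he hF'γ), hcut.2⟩
      rw [Finset.sum_eq_single_of_mem (insert e F') hmem fun B hB hB' => if_neg fun h => hB' ?_]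
      · exact if_pos ((sdiff_add_single_eq_iff (Finset.insert_subset he hF'γ) hF'γ he).2 ⟨hcut.1, rfl⟩)
      · exact ((sdiff_add_single_eq_iff (Finset.mem_powerset.1 (Finset.mem_filter.1 hB).1) hF'γ he).1 h).2
    · rw [if_neg hcut]
      refine Finset.sum_eq_zero fun B hB => if_neg fun h => hcut ?_
      have hBγ : B ⊆ γ := Finset.mem_powerset.1 (Finset.mem_filter.1 hB).1
      obtain ⟨heF, rfl⟩ := (sdiff_add_single_eq_iff hBγ hF'γ he).1 h
      exact ⟨heF, (Finset.mem_filter.1 hB).2⟩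

open scoped Classical in
/-- **The coefficient of the mass monomial `x_e · x^{𝟙_{γ∖B}}` of `ℱ_γ(𝒫)`** (`B` a maximal forest of `γ`, `e ∈ γ ∖ B`) is `m_e²`.
[cite: Brown2017, Thm 2.7 eq. (XiIRfact) and Lemma 1.13 (proof); BorinskyMunchTellander2023, §2.1 eq. (polyUF)] -/
theorem coeff_gramSecondSymanzikSub_basis_add_single (γ : Finset (Fin N)) (P : Matrix (Fin (V + 1)) (Fin (V + 1)) ℝ)
    (m : Fin N → ℝ) (a : Fin (V + 1)) {B : Finset (Fin N)} (hBγ : B ⊆ γ)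
    (hB : (cycleMatroid E).IsBasis (↑B : Set (Fin N)) (↑γ : Set (Fin N))) {e : Fin N} (he : e ∈ γ) (heB : e ∉ B) :
    coeff (∑ e' ∈ γ \ B, Finsupp.single e' 1 + Finsupp.single e 1) (gramSecondSymanzikSub E γ P m a) = m e ^ 2 := by
  rw [coeff_gramSecondSymanzikSub, Finset.sum_eq_zero fun F' _ => if_neg (sdiff_ne_sdiff_add_single he heB), zero_add]
  have hmem : B ∈ γ.powerset.filter
      (fun B : Finset (Fin N) => (cycleMatroid E).IsBasis (↑B : Set (Fin N)) (↑γ : Set (Fin N))) :=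
    Finset.mem_filter.2 ⟨Finset.mem_powerset.2 hBγ, hB⟩
  rw [Finset.sum_eq_single_of_mem B hmem fun B' hB' hB'B => ?_]
  · rw [Finset.sum_eq_single_of_mem e he fun e' _ he' => if_neg fun h => he' ?_]
    · exact if_pos rfl
    · exact (sdiff_add_single_inj hBγ hBγ he heB h).2
  · refine Finset.sum_eq_zero fun e' _ => if_neg fun h => hB'B ?_
    exact (sdiff_add_single_inj hBγ (Finset.mem_powerset.1 (Finset.mem_filter.1 hB').1) he heB h).1

open scoped Classical in
/-- The monomials of `ℱ_γ(𝒫)`: `x^{𝟙_{γ∖F'}}` for a spanning 2-forest `F'` of `γ`, or `x_e x^{𝟙_{γ∖B}}` for a maximal forest `B` of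
`γ` and `e ∈ γ` ("deg Φ_γ(q) = h_γ + 1"). [cite: Brown2017, Prop. 2.4; Schultka2018, Proposition 4.11 (1)] -/
theorem exists_of_coeff_gramSecondSymanzikSub_ne_zero {γ : Finset (Fin N)} {P : Matrix (Fin (V + 1)) (Fin (V + 1)) ℝ}
    {m : Fin N → ℝ} {a : Fin (V + 1)} {d : Fin N →₀ ℕ} (hd : coeff d (gramSecondSymanzikSub E γ P m a) ≠ 0) :
    (∃ F', F' ⊆ γ ∧ (edgeRank E F' = F'.card ∧ F'.card + 1 = edgeRank E γ) ∧ d = ∑ e' ∈ γ \ F', Finsupp.single e' 1) ∨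
      ∃ B, B ⊆ γ ∧ (cycleMatroid E).IsBasis (↑B : Set (Fin N)) (↑γ : Set (Fin N)) ∧
        ∃ e ∈ γ, d = ∑ e' ∈ γ \ B, Finsupp.single e' 1 + Finsupp.single e 1 := by
  by_contra hno
  push Not at hno
  obtain ⟨h1, h2⟩ := hno
  apply hd
  rw [coeff_gramSecondSymanzikSub, Finset.sum_eq_zero, zero_add, Finset.sum_eq_zero]
  · intro B hB
    refine Finset.sum_eq_zero fun e he => if_neg fun h => ?_
    exact h2 B (Finset.mem_powerset.1 (Finset.mem_filter.1 hB).1) (Finset.mem_filter.1 hB).2 e he h.symm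
  · intro F' hF'
    exact if_neg fun h => h1 F' (Finset.mem_powerset.1 (Finset.mem_filter.1 hF').1) (Finset.mem_filter.1 hF').2 h.symm

/-- Every monomial of `ℱ_γ(𝒫)` lives in the variables of `γ`. [cite: Brown2017, Prop. 2.4] -/
theorem apply_eq_zero_of_mem_support_gramSecondSymanzikSub {γ : Finset (Fin N)} {P : Matrix (Fin (V + 1)) (Fin (V + 1)) ℝ}
    {m : Fin N → ℝ} {a : Fin (V + 1)} {d : Fin N →₀ ℕ} (hd : d ∈ (gramSecondSymanzikSub E γ P m a).support) {e : Fin N}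
    (he : e ∉ γ) : d e = 0 := by
  classical
  rcases exists_of_coeff_gramSecondSymanzikSub_ne_zero (mem_support_iff.1 hd) with ⟨F', -, -, rfl⟩ | ⟨B, -, -, e', he', rfl⟩
  · rw [sum_single_apply, if_neg fun h => he (Finset.mem_sdiff.1 h).1]
  · rw [Finsupp.add_apply, sum_single_apply, if_neg fun h => he (Finset.mem_sdiff.1 h).1, Finsupp.single_apply,
      if_neg fun h => he (by rw [← h]; exact he'), add_zero]

/-- Every monomial of `ℱ_γ(𝒫)` has exactly `L_γ + 1` variables of `γ` ("deg Φ_γ(q) = h_γ + 1"). [cite: Brown2017, Prop. 2.4; Schultka2018, Proposition 4.11 (1)] -/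
theorem gammaDeg_of_mem_support_gramSecondSymanzikSub {γ : Finset (Fin N)} {P : Matrix (Fin (V + 1)) (Fin (V + 1)) ℝ}
    {m : Fin N → ℝ} {a : Fin (V + 1)} {d : Fin N →₀ ℕ} (hd : d ∈ (gramSecondSymanzikSub E γ P m a).support) :
    ∑ e ∈ γ, d e = loopNumber E γ + 1 := by
  classical
  have hrk := edgeRank_le_card E γ
  rcases exists_of_coeff_gramSecondSymanzikSub_ne_zero (mem_support_iff.1 hd) with
    ⟨F', hF'γ, hF', rfl⟩ | ⟨B, hBγ, hB, e, he, rfl⟩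
  · rw [gammaDeg_sum_single, Finset.inter_eq_right.2 Finset.sdiff_subset, Finset.card_sdiff_of_subset hF'γ, loopNumber]
    have := Finset.card_le_card hF'γ
    omega
  · have hcardB : B.card = edgeRank E γ := ((isBasis_cycleMatroid_iff E B γ).1 hB).2.2
    simp only [Finsupp.add_apply, Finset.sum_add_distrib]
    rw [gammaDeg_sum_single, Finset.inter_eq_right.2 Finset.sdiff_subset, Finset.card_sdiff_of_subset hBγ, loopNumber, hcardB]
    simp only [Finsupp.single_apply]
    rw [Finset.sum_ite_eq, if_pos he]

open scoped Classical in
/-- The monomials of `Ψ_{G/γ}`: `x^{𝟙_{(E∖γ)∖B'}}` for a spanning tree `B'` of `G/γ` (base of `M(G)/γ`), coefficient `1`.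
[cite: Brown2017, Prop. 2.2 and §1.4; Oxley2011, §3.1 Prop. 3.1.7] -/
theorem exists_of_coeff_kirchhoffQuot_ne_zero {γ : Finset (Fin N)} {b : Fin N →₀ ℕ} (hb : coeff b (kirchhoffQuot E γ) ≠ 0) :
    ∃ B', B' ⊆ γᶜ ∧ ((cycleMatroid E) ／ (↑γ : Set (Fin N))).IsBase (↑B' : Set (Fin N)) ∧
      b = ∑ e' ∈ γᶜ \ B', Finsupp.single e' 1 := by
  by_contra hno
  push Not at hno
  apply hb
  rw [kirchhoffQuot, coeff_sum]
  refine Finset.sum_eq_zero fun B' hB' => ?_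
  rw [prod_X_eq_monomial, coeff_monomial]
  exact if_neg fun h => hno B' (Finset.mem_powerset.1 (Finset.mem_filter.1 hB').1) (Finset.mem_filter.1 hB').2 h.symm

open scoped Classical in
/-- `[x^{𝟙_{(E∖γ)∖B'}}] Ψ_{G/γ} = 1` for a base `B'` of `M(G)/γ`. [cite: Brown2017, Prop. 2.2 and §1.4; Oxley2011, §3.1 Prop. 3.1.7] -/
theorem coeff_kirchhoffQuot_base {γ B' : Finset (Fin N)} (hB'γ : B' ⊆ γᶜ)
    (hB' : ((cycleMatroid E) ／ (↑γ : Set (Fin N))).IsBase (↑B' : Set (Fin N))) :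
    coeff (∑ e' ∈ γᶜ \ B', Finsupp.single e' (1 : ℕ)) (kirchhoffQuot E γ) = 1 := by
  rw [kirchhoffQuot, coeff_sum]
  simp only [prod_X_eq_monomial, coeff_monomial]
  rw [Finset.sum_eq_single_of_mem B' (Finset.mem_filter.2 ⟨Finset.mem_powerset.2 hB'γ, hB'⟩)
    (fun B hB hne => if_neg fun heq => hne ?_), if_pos rfl]
  have hBγ : B ⊆ γᶜ := Finset.mem_powerset.1 (Finset.mem_filter.1 hB).1
  rw [← Finset.sdiff_sdiff_eq_self hBγ, sum_single_injective heq, Finset.sdiff_sdiff_eq_self hB'γ]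

/-- Every monomial of `Ψ_{G/γ}` lives in the variables of `E ∖ γ`. [cite: Brown2017, Prop. 2.2] -/
theorem apply_eq_zero_of_mem_support_kirchhoffQuot {γ : Finset (Fin N)} {b : Fin N →₀ ℕ}
    (hb : b ∈ (kirchhoffQuot E γ).support) {e : Fin N} (he : e ∈ γ) : b e = 0 := by
  classical
  obtain ⟨B', -, -, rfl⟩ := exists_of_coeff_kirchhoffQuot_ne_zero (mem_support_iff.1 hb)
  rw [sum_single_apply, if_neg fun h => (Finset.mem_compl.1 (Finset.mem_sdiff.1 h).1) he]

/-- Every monomial of `ℱ_γ(𝒫) · Ψ_{G/γ}` has exactly `L_γ + 1` variables of `γ`. [cite: Brown2017, Thm 2.7 eq. (XiIRfact); Schultka2018, Proposition 4.11 (1)] -/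
theorem gammaDeg_of_mem_support_sub_mul_quot {γ : Finset (Fin N)} {P : Matrix (Fin (V + 1)) (Fin (V + 1)) ℝ} {m : Fin N → ℝ}
    {a : Fin (V + 1)} {d : Fin N →₀ ℕ} (hd : d ∈ (gramSecondSymanzikSub E γ P m a * kirchhoffQuot E γ).support) :
    ∑ e ∈ γ, d e = loopNumber E γ + 1 := by
  classical
  obtain ⟨a', ha', b, hb, rfl⟩ := Finset.mem_add.1 (support_mul _ _ hd)
  simp only [Finsupp.add_apply, Finset.sum_add_distrib]
  rw [gammaDeg_of_mem_support_gramSecondSymanzikSub ha', gammaDeg_of_mem_support_kirchhoffQuot E hb, add_zero]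

end SubPolynomial

/-! ## Part 3 — the squared momentum across a 2-forest `S` of `G` near the IR face of an m.m. `γ`, read off `𝒫` -/

section Flows

variable {P : Matrix (Fin (V + 1)) (Fin (V + 1)) ℝ}

/-- If every external vertex is reached from `a` inside `S`, the root side of `S` has squared momentum `0`.
[cite: Brown2017, Prop. 2.4 (proof: "q^{T_i} = 0 because γ' is momentum-spanning"); BorinskyMunchTellander2023, §2.2 (main.tex l.330–331)] -/
theorem sqMomentum_rootSide_eq_zero_of_forall_reachable (hP : P.IsSymm) (hcons : ∀ u, ∑ v, P u v = 0) {S : Finset (Fin N)}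
    {a : Fin (V + 1)} (h : ∀ v, IsExternal P v → (edgeGraph E S).Reachable a v) : sqMomentum P (rootSide E S) = 0 :=
  sqMomentum_rootSide_eq_zero hP hcons fun u v hu hv => (h u hu).symm.trans (h v hv)

/-- **A 2-forest meeting the m.m. `γ` maximally carries no squared momentum**: if `S` is a forest with `|S ∩ γ| = rk γ`, then `S ∩ γ`
spans `γ`, all external vertices lie on one side of `S`, and `Σ_{u,v ∈ root side} 𝒫^{u,v} = 0`. [cite: Brown2017, Prop. 2.4 (proof, arXiv:1512.06409 §2.2)] -/
theorem sqMomentum_rootSide_eq_zero_of_card_inter_eq (hP : P.IsSymm) (hcons : ∀ u, ∑ v, P u v = 0) {γ S : Finset (Fin N)}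
    {a : Fin (V + 1)} (ha : ∀ v, IsExternal P v → (edgeGraph E γ).Reachable a v) (hS : edgeRank E S = S.card)
    (hcard : (S ∩ γ).card = edgeRank E γ) : sqMomentum P (rootSide E S) = 0 := by
  have hrk : edgeRank E (S ∩ γ) = edgeRank E γ := by
    rw [edgeRank_eq_card_of_subset hS Finset.inter_subset_left, hcard]
  exact sqMomentum_rootSide_eq_zero_of_forall_reachable hP hcons fun v hv =>
    ((reachable_iff_reachable_of_subset_of_edgeRank_eq E Finset.inter_subset_right hrk a v).2 (ha v hv)).mono
      (edgeGraph_mono Finset.inter_subset_left)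

/-- **A 2-forest one edge short of spanning `γ` whose outside part does NOT span `G/γ` carries no squared momentum**.
[cite: Brown2017, Prop. 2.4 (proof: the classes C_1, C_2)] -/
theorem sqMomentum_rootSide_eq_zero_of_not_contract_indep (hP : P.IsSymm) (hcons : ∀ u, ∑ v, P u v = 0) {γ S : Finset (Fin N)}
    {a : Fin (V + 1)} (ha : ∀ v, IsExternal P v → (edgeGraph E γ).Reachable a v) (hS : IsSpanningTwoForest E S)
    (hcard : (S ∩ γ).card + 1 = edgeRank E γ)
    (hdep : ¬ ((cycleMatroid E) ／ (γ : Set (Fin N))).Indep ((S \ γ : Finset (Fin N)) : Set (Fin N))) :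
    sqMomentum P (rootSide E S) = 0 := by
  have hind : (cycleMatroid E).Indep ((S ∩ γ : Finset (Fin N)) : Set (Fin N)) :=
    (indep_cycleMatroid_iff_edgeRank E _).2 (edgeRank_eq_card_of_subset hS.2 Finset.inter_subset_left)
  obtain ⟨F₀, hF₀, -⟩ := hind.subset_isBasis_of_subset (Finset.coe_subset.2 Finset.inter_subset_right)
  obtain ⟨F, rfl⟩ : ∃ F : Finset (Fin N), (F : Set (Fin N)) = F₀ := ⟨(Set.toFinite F₀).toFinset, by simp⟩
  have hFγ := (isBasis_cycleMatroid_iff E F γ).1 hF₀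
  have hdisj : Disjoint (γ : Set (Fin N)) ((S \ γ : Finset (Fin N)) : Set (Fin N)) := by
    rw [Finset.disjoint_coe]; exact Finset.disjoint_sdiff
  rw [hF₀.contract_indep_iff_of_disjoint hdisj, ← Finset.coe_union, indep_cycleMatroid_iff_edgeRank] at hdep
  have hB : edgeRank E (γ ∪ S \ γ) = edgeRank E S := by
    have h1 : edgeRank E S ≤ edgeRank E (γ ∪ S \ γ) :=
      edgeRank_mono fun e he => by
        by_cases heγ : e ∈ γ
        · exact Finset.mem_union_left _ heγ
        · exact Finset.mem_union_right _ (Finset.mem_sdiff.2 ⟨he, heγ⟩)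
    have h2 : edgeRank E (γ ∪ S \ γ) = edgeRank E (S \ γ ∪ F) := by
      rw [Finset.union_comm (S \ γ) F, edgeRank_union_eq_of_isBasis E hF₀]
    have h3 : edgeRank E (S \ γ ∪ F) ≤ (S \ γ ∪ F).card := edgeRank_le_card E _
    have h4 : (S \ γ ∪ F).card = (S \ γ).card + F.card :=
      Finset.card_union_of_disjoint (Finset.disjoint_sdiff.symm.mono_right hFγ.1)
    have h5 := Finset.card_sdiff_add_card_inter S γ
    have h6 := hS.1
    have h7 := hS.2
    have h8 := hFγ.2.2
    omega
  have hsub : S ⊆ γ ∪ S \ γ := fun e he => by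
    by_cases heγ : e ∈ γ
    · exact Finset.mem_union_left _ heγ
    · exact Finset.mem_union_right _ (Finset.mem_sdiff.2 ⟨he, heγ⟩)
  exact sqMomentum_rootSide_eq_zero_of_forall_reachable hP hcons fun v hv =>
    (reachable_iff_reachable_of_subset_of_edgeRank_eq E hsub hB.symm a v).2
      ((ha v hv).mono (edgeGraph_mono Finset.subset_union_left))

open scoped Classical in
/-- **The squared momentum of a class-`C_1` 2-forest is the one across the induced 2-forest of `γ`**: if the spanning 2-forest `S`
meets `γ` one edge short of maximally and `S ∖ γ` spans `G/γ`, then inside the momentum component of `γ` the components of `S` are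
those of `S ∩ γ` (strict submodularity), so `Σ_{u,v ∈ root side of S} 𝒫^{u,v} = Σ_{u,v ~_{S∩γ} a} 𝒫^{u,v}` — independently of `S ∖ γ`.
[cite: Brown2017, Prop. 2.4 (proof: the bijection for C_1); Schultka2018, Proposition 4.11 proof sketch (toricfeynman.tex l.2294–2304)] -/
theorem sqMomentum_rootSide_eq_of_contract_indep (hP : P.IsSymm) (hcons : ∀ u, ∑ v, P u v = 0) {γ S : Finset (Fin N)}
    {a : Fin (V + 1)} (ha : ∀ v, IsExternal P v → (edgeGraph E γ).Reachable a v) (hS : IsSpanningTwoForest E S)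
    (hcard : (S ∩ γ).card + 1 = edgeRank E γ)
    (hind : ((cycleMatroid E) ／ (γ : Set (Fin N))).Indep ((S \ γ : Finset (Fin N)) : Set (Fin N))) :
    sqMomentum P (rootSide E S) = sqMomentum P (univ.filter fun v => (edgeGraph E (S ∩ γ)).Reachable a v) := by
  obtain ⟨F, hF⟩ := exists_isBasis_cycleMatroid E γ
  have hFγ := (isBasis_cycleMatroid_iff E F γ).1 hF
  have hdisj : Disjoint (γ : Set (Fin N)) ((S \ γ : Finset (Fin N)) : Set (Fin N)) := by
    rw [Finset.disjoint_coe]; exact Finset.disjoint_sdiff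
  rw [hF.contract_indep_iff_of_disjoint hdisj, ← Finset.coe_union, indep_cycleMatroid_iff_edgeRank] at hind
  have hSγ : edgeRank E (S ∪ γ) = V := by
    have h1 : S ∪ γ = γ ∪ S \ γ := by
      ext e
      simp only [Finset.mem_union, Finset.mem_sdiff]
      tauto
    have h4 : (S \ γ ∪ F).card = (S \ γ).card + F.card :=
      Finset.card_union_of_disjoint (Finset.disjoint_sdiff.symm.mono_right hFγ.1)
    rw [h1, ← edgeRank_union_eq_of_isBasis E hF (S \ γ), Finset.union_comm F (S \ γ), hind, h4, hFγ.2.2]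
    have h5 := Finset.card_sdiff_add_card_inter S γ
    have h6 := hS.1
    omega
  -- (K): inside the momentum component, `S`-reachability from `a` is `S ∩ γ`-reachability
  have hK : ∀ u, (edgeGraph E γ).Reachable a u →
      ((edgeGraph E S).Reachable a u ↔ (edgeGraph E (S ∩ γ)).Reachable a u) := by
    intro u hγ
    refine ⟨fun hSu => ?_, fun h => h.mono (edgeGraph_mono Finset.inter_subset_left)⟩
    by_contra hnot
    have hstrict := edgeRank_union_add_inter_add_one_le E hSu hγ hnot
    rw [hSγ, edgeRank_eq_card_of_subset hS.2 Finset.inter_subset_left, hS.2] at hstrict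
    have h6 := hS.1
    omega
  -- the external vertices on `a`'s side, in `S` and in `S ∩ γ`, coincide
  have hfilter : (univ.filter fun v => (edgeGraph E S).Reachable a v).filter (fun v => IsExternal P v) =
      (univ.filter fun v => (edgeGraph E (S ∩ γ)).Reachable a v).filter (fun v => IsExternal P v) := by
    rw [Finset.filter_filter, Finset.filter_filter]
    refine Finset.filter_congr fun v _ => ⟨fun h => ⟨(hK v (ha v h.2)).1 h.1, h.2⟩, fun h => ⟨(hK v (ha v h.2)).2 h.1, h.2⟩⟩
  have hsideA : sqMomentum P (univ.filter fun v => (edgeGraph E S).Reachable a v) =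
      sqMomentum P (univ.filter fun v => (edgeGraph E (S ∩ γ)).Reachable a v) := by
    rw [sqMomentum_eq_filter_isExternal hP, hfilter, ← sqMomentum_eq_filter_isExternal hP]
  by_cases h0 : (edgeGraph E S).Reachable 0 a
  · have h1 : rootSide E S = univ.filter fun v => (edgeGraph E S).Reachable a v := by
      unfold rootSide
      exact Finset.filter_congr fun v _ => ⟨fun h => h0.symm.trans h, fun h => h0.trans h⟩
    rw [h1, hsideA]
  · have h1 : rootSide E S = (univ.filter fun v => (edgeGraph E S).Reachable a v)ᶜ := by
      unfold rootSide
      ext v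
      rw [Finset.mem_compl, Finset.mem_filter, Finset.mem_filter]
      simp only [Finset.mem_univ, true_and]
      exact hS.reachable_iff_not_reachable h0 v
    rw [h1, sqMomentum_compl hP hcons, hsideA]

end Flows

/-! ## Part 4 — the monomials with exactly `L_γ + 1` variables of `γ`: their coefficients in `ℱ_G(𝒫)` and in `ℱ_γ(𝒫) · Ψ_{G/γ}` -/

section Leading

variable {P : Matrix (Fin (V + 1)) (Fin (V + 1)) ℝ}

open scoped Classical in
/-- For a class-`C_1` 2-forest `S` (`|S ∩ γ| = rk γ − 1`, `S ∖ γ` a base of `M(G)/γ`) of a connected graph with all masses inside `γ`: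
the massive part of the cut of `S` in `G` is the cut of `S ∩ γ` INSIDE `γ`. [cite: Brown2017, Prop. 2.4 (proof) and Thm 2.7 (proof of (XiIRfact): "use the condition m_e ≠ 0 ⇒ e ∈ E_γ")] -/
theorem sum_cutEdges_eq_sum_subCutEdges (hconn : IsConnectedEdgeList E) {m : Fin N → ℝ} {γ S : Finset (Fin N)}
    (hmass : ∀ e, m e ≠ 0 → e ∈ γ) (hS : IsSpanningTwoForest E S) (hcard : (S ∩ γ).card + 1 = edgeRank E γ)
    (hind : ((cycleMatroid E) ／ (γ : Set (Fin N))).Indep ((S \ γ : Finset (Fin N)) : Set (Fin N))) :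
    ∑ e ∈ cutEdges E S, m e ^ 2 = ∑ e ∈ subCutEdges E γ (S ∩ γ), m e ^ 2 := by
  -- `S ∖ γ` is a base of `M(G)/γ`
  have hbase : ((cycleMatroid E) ／ (γ : Set (Fin N))).IsBase ((S \ γ : Finset (Fin N)) : Set (Fin N)) := by
    refine (contract_isBase_iff_indep_card E hconn (fun x hx => Finset.mem_compl.2 (Finset.mem_sdiff.1 hx).2)).2 ⟨hind, ?_⟩
    have h5 := Finset.card_sdiff_add_card_inter S γ
    have h6 := hS.1
    omega
  -- the massive edges of `cutEdges E S` are in `γ`, and for `e ∈ γ`: `S + e` spanning tree iff `(S ∩ γ) + e` basis of `γ`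
  have hkey : ∀ e, e ∈ γ → (e ∉ S ∧ IsSpanningTree E (insert e S) ↔
      e ∉ S ∩ γ ∧ (cycleMatroid E).IsBasis (↑(insert e (S ∩ γ)) : Set (Fin N)) (↑γ : Set (Fin N))) := by
    intro e heγ
    constructor
    · rintro ⟨heS, hT⟩
      refine ⟨fun h => heS (Finset.mem_inter.1 h).1, (isBasis_cycleMatroid_iff E _ γ).2
        ⟨Finset.insert_subset heγ Finset.inter_subset_right, ?_, ?_⟩⟩
      · have : insert e (S ∩ γ) ⊆ insert e S := Finset.insert_subset_insert e Finset.inter_subset_left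
        exact edgeRank_eq_card_of_subset (hT.2.trans hT.1.symm) this
      · rw [Finset.card_insert_of_notMem fun h => heS (Finset.mem_inter.1 h).1]
        exact hcard
    · rintro ⟨heSγ, hB⟩
      have heS : e ∉ S := fun h => heSγ (Finset.mem_inter.2 ⟨h, heγ⟩)
      refine ⟨heS, ?_⟩
      have hdisj : Disjoint (S \ γ) γ := Finset.sdiff_disjoint
      have h := (contract_isBase_iff_of_isBasis E hB hdisj).1 hbase
      rw [isBase_cycleMatroid_iff_isSpanningTree E hconn] at h
      have hset : S \ γ ∪ insert e (S ∩ γ) = insert e S := by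
        rw [Finset.union_insert, Finset.sdiff_union_inter]
      rwa [hset] at h
  -- split the cut sum into its `γ` part and the rest (massless)
  have hsplit : ∑ e ∈ cutEdges E S, m e ^ 2 = ∑ e ∈ (cutEdges E S).filter (· ∈ γ), m e ^ 2 := by
    rw [Finset.sum_filter]
    refine Finset.sum_congr rfl fun e _ => ?_
    by_cases heγ : e ∈ γ
    · rw [if_pos heγ]
    · have : m e = 0 := by
        by_contra h
        exact heγ (hmass e h)
      rw [if_neg heγ, this]
      ring
  rw [hsplit]
  refine Finset.sum_congr ?_ fun _ _ => rfl
  ext e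
  rw [Finset.mem_filter, cutEdges, Finset.mem_filter, subCutEdges, Finset.mem_filter]
  constructor
  · rintro ⟨⟨-, heS, hT⟩, heγ⟩
    exact ⟨heγ, (hkey e heγ).1 ⟨heS, hT⟩⟩
  · rintro ⟨heγ, h⟩
    exact ⟨⟨Finset.mem_univ _, (hkey e heγ).2 h⟩, heγ⟩

open scoped Classical in
/-- For a 2-forest `S` with `|S ∩ γ| = rk γ − 1` whose outside part does NOT span `G/γ`, no edge of `γ` completes `S` to a spanning
tree; with all masses inside `γ` the cut of `S` is massless. [cite: Brown2017, Prop. 2.4 (proof: class C_2) and Thm 2.7 (proof)] -/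
theorem sum_cutEdges_eq_zero_of_not_contract_indep {m : Fin N → ℝ} {γ S : Finset (Fin N)}
    (hmass : ∀ e, m e ≠ 0 → e ∈ γ) (hcard : (S ∩ γ).card + 1 = edgeRank E γ)
    (hdep : ¬ ((cycleMatroid E) ／ (γ : Set (Fin N))).Indep ((S \ γ : Finset (Fin N)) : Set (Fin N))) :
    ∑ e ∈ cutEdges E S, m e ^ 2 = 0 := by
  refine Finset.sum_eq_zero fun e he => ?_
  obtain ⟨-, heS, hT⟩ := Finset.mem_filter.1 he
  by_cases heγ : e ∈ γ
  · exfalso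
    apply hdep
    -- `(S + e) ∩ γ` is a basis of `γ`, and `S ∖ γ = (S + e) ∖ γ` is independent in `M(G)/γ`
    have hB : (cycleMatroid E).IsBasis (↑(insert e (S ∩ γ)) : Set (Fin N)) (↑γ : Set (Fin N)) := by
      refine (isBasis_cycleMatroid_iff E _ γ).2 ⟨Finset.insert_subset heγ Finset.inter_subset_right, ?_, ?_⟩
      · exact edgeRank_eq_card_of_subset (hT.2.trans hT.1.symm) (Finset.insert_subset_insert e Finset.inter_subset_left)
      · rw [Finset.card_insert_of_notMem fun h => heS (Finset.mem_inter.1 h).1]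
        exact hcard
    have hdisj : Disjoint (γ : Set (Fin N)) ((S \ γ : Finset (Fin N)) : Set (Fin N)) := by
      rw [Finset.disjoint_coe]; exact Finset.disjoint_sdiff
    rw [hB.contract_indep_iff_of_disjoint hdisj, ← Finset.coe_union, Finset.union_insert, Finset.sdiff_union_inter,
      indep_cycleMatroid_iff_edgeRank]
    exact hT.2.trans hT.1.symm
  · have : m e = 0 := by
      by_contra h
      exact heγ (hmass e h)
    rw [this]
    ring

/-- Extending a spanning 2-forest `F'` of the subgraph `γ` by a spanning tree `B'` of `G/γ` gives a spanning 2-forest of `G` meeting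
`γ` in `F'` (the inverse of Brown's bijection for `C_1`). [cite: Brown2017, Prop. 2.4 (proof: the bijection for C_1); Oxley2011, §3.1 Prop. 3.1.7] -/
theorem isSpanningTwoForest_union_of_sub (hconn : IsConnectedEdgeList E) {γ F' B' : Finset (Fin N)} (hF'γ : F' ⊆ γ)
    (hF' : edgeRank E F' = F'.card ∧ F'.card + 1 = edgeRank E γ) (hB'γ : B' ⊆ γᶜ)
    (hB' : ((cycleMatroid E) ／ (↑γ : Set (Fin N))).IsBase (↑B' : Set (Fin N))) :
    IsSpanningTwoForest E (F' ∪ B') ∧ (F' ∪ B') ∩ γ = F' ∧ (F' ∪ B') \ γ = B' := by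
  -- extend `F'` to a basis `B₀` of `γ`; `B₀ ∪ B'` is a spanning tree containing `F' ∪ B'`
  have hind : (cycleMatroid E).Indep (↑F' : Set (Fin N)) := (indep_cycleMatroid_iff_edgeRank E _).2 hF'.1
  obtain ⟨B₀s, hB₀s, hFB₀⟩ := hind.subset_isBasis_of_subset (Finset.coe_subset.2 hF'γ)
  obtain ⟨B₀, rfl⟩ : ∃ B₀ : Finset (Fin N), (B₀ : Set (Fin N)) = B₀s := ⟨(Set.toFinite B₀s).toFinset, by simp⟩
  have hB₀γ := (isBasis_cycleMatroid_iff E B₀ γ).1 hB₀s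
  obtain ⟨hT, -, -⟩ := isSpanningTree_union hconn hB₀γ.1 hB₀s hB'γ hB'
  have hdisj : Disjoint F' B' := Finset.disjoint_left.2 fun e h1 h2 => (Finset.mem_compl.1 (hB'γ h2)) (hF'γ h1)
  have hsub : F' ∪ B' ⊆ B₀ ∪ B' := Finset.union_subset_union (Finset.coe_subset.1 hFB₀) (Finset.Subset.refl _)
  have hcardB' := ((contract_isBase_iff_indep_card E hconn hB'γ).1 hB').2
  refine ⟨⟨?_, edgeRank_eq_card_of_subset (hT.2.trans hT.1.symm) hsub⟩, ?_, ?_⟩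
  · rw [Finset.card_union_of_disjoint hdisj]
    have := hF'.2
    omega
  · rw [Finset.union_inter_distrib_right, Finset.inter_eq_left.2 hF'γ,
      Finset.disjoint_iff_inter_eq_empty.1 (Finset.disjoint_left.2 fun e he heγ => (Finset.mem_compl.1 (hB'γ he)) heγ),
      Finset.union_empty]
  · rw [Finset.union_sdiff_distrib, Finset.sdiff_eq_empty_iff_subset.2 hF'γ, Finset.empty_union,
      Finset.sdiff_eq_self_iff_disjoint.2 (Finset.disjoint_left.2 fun e he heγ => (Finset.mem_compl.1 (hB'γ he)) heγ)]

/-- **(C1, IR) A class-`C_1` 2-forest monomial has the same coefficient in `ℱ_G(𝒫)` and in `ℱ_γ(𝒫) · Ψ_{G/γ}`** (γ carrying all masses,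
every external vertex reached from `a` inside `γ`): both equal `−Σ_{u,v ~_{S∩γ} a} 𝒫^{u,v} + Σ_{cut_γ(S∩γ)} m_e²`.
[cite: Brown2017, Prop. 2.4 (proof) and Thm 2.7 eq. (XiIRfact)] -/
theorem coeff_twoForest_eq_coeff_sub_mul_of_indep (hconn : IsConnectedEdgeList E) (hP : P.IsSymm) (hcons : ∀ u, ∑ v, P u v = 0)
    {m : Fin N → ℝ} {γ S : Finset (Fin N)} {a : Fin (V + 1)} (hmass : ∀ e, m e ≠ 0 → e ∈ γ)
    (ha : ∀ v, IsExternal P v → (edgeGraph E γ).Reachable a v) (hS : IsSpanningTwoForest E S)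
    (hcard : (S ∩ γ).card + 1 = edgeRank E γ)
    (hind : ((cycleMatroid E) ／ (γ : Set (Fin N))).Indep ((S \ γ : Finset (Fin N)) : Set (Fin N))) :
    coeff (∑ e' ∈ Sᶜ, Finsupp.single e' 1) (gramSecondSymanzik E P m) =
      coeff (∑ e' ∈ Sᶜ, Finsupp.single e' 1) (gramSecondSymanzikSub E γ P m a * kirchhoffQuot E γ) := by
  classical
  have hbase : ((cycleMatroid E) ／ (γ : Set (Fin N))).IsBase ((S \ γ : Finset (Fin N)) : Set (Fin N)) := by
    refine (contract_isBase_iff_indep_card E hconn (fun x hx => Finset.mem_compl.2 (Finset.mem_sdiff.1 hx).2)).2 ⟨hind, ?_⟩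
    have h5 := Finset.card_sdiff_add_card_inter S γ
    have h6 := hS.1
    omega
  have hsub2 : edgeRank E (S ∩ γ) = (S ∩ γ).card ∧ (S ∩ γ).card + 1 = edgeRank E γ :=
    ⟨edgeRank_eq_card_of_subset hS.2 Finset.inter_subset_left, hcard⟩
  rw [gramSecondSymanzik, coeff_twoForestPolynomial_twoForest _ m hS, sum_single_compl_eq_add S γ,
    coeff_add_mul_of_separated (fun a ha e he => apply_eq_zero_of_mem_support_gramSecondSymanzikSub ha he)
      (fun b hb e he => apply_eq_zero_of_mem_support_kirchhoffQuot hb he)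
      (fun e he => by rw [sum_single_apply, if_neg fun h => he (Finset.mem_sdiff.1 h).1])
      (fun e he => by rw [sum_single_apply, if_neg fun h => (Finset.mem_compl.1 (Finset.mem_sdiff.1 h).1) he]),
    coeff_gramSecondSymanzikSub_twoForest γ P m a Finset.inter_subset_right hsub2,
    coeff_kirchhoffQuot_base (fun x hx => Finset.mem_compl.2 (Finset.mem_sdiff.1 hx).2) hbase, mul_one,
    sqMomentum_rootSide_eq_of_contract_indep hP hcons ha hS hcard hind, sum_cutEdges_eq_sum_subCutEdges hconn hmass hS hcard hind]

/-- **(C2, IR) A class-`C_2` 2-forest monomial has coefficient `0` on both sides** (no squared momentum, massless cut; `S ∖ γ` is no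
spanning tree of `G/γ`). [cite: Brown2017, Prop. 2.4 (proof: class C_2 "contributes to R^{Φ,IR}")] -/
theorem coeff_twoForest_eq_coeff_sub_mul_of_not_indep (hP : P.IsSymm) (hcons : ∀ u, ∑ v, P u v = 0) {m : Fin N → ℝ} {γ S : Finset (Fin N)} {a : Fin (V + 1)} (hmass : ∀ e, m e ≠ 0 → e ∈ γ)
    (ha : ∀ v, IsExternal P v → (edgeGraph E γ).Reachable a v) (hS : IsSpanningTwoForest E S)
    (hcard : (S ∩ γ).card + 1 = edgeRank E γ)
    (hdep : ¬ ((cycleMatroid E) ／ (γ : Set (Fin N))).Indep ((S \ γ : Finset (Fin N)) : Set (Fin N))) :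
    coeff (∑ e' ∈ Sᶜ, Finsupp.single e' 1) (gramSecondSymanzik E P m) =
      coeff (∑ e' ∈ Sᶜ, Finsupp.single e' 1) (gramSecondSymanzikSub E γ P m a * kirchhoffQuot E γ) := by
  classical
  have hq : coeff (∑ e' ∈ γᶜ \ (S \ γ), Finsupp.single e' (1 : ℕ)) (kirchhoffQuot E γ) = 0 := by
    by_contra h
    obtain ⟨B', hB'γ, hB', heq⟩ := exists_of_coeff_kirchhoffQuot_ne_zero h
    have hSγ : S \ γ ⊆ γᶜ := fun x hx => Finset.mem_compl.2 (Finset.mem_sdiff.1 hx).2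
    have : S \ γ = B' := by
      rw [← Finset.sdiff_sdiff_eq_self hSγ, sum_single_injective heq, Finset.sdiff_sdiff_eq_self hB'γ]
    exact hdep (this ▸ hB'.indep)
  rw [gramSecondSymanzik, coeff_twoForestPolynomial_twoForest _ m hS, sum_single_compl_eq_add S γ,
    coeff_add_mul_of_separated (fun a ha e he => apply_eq_zero_of_mem_support_gramSecondSymanzikSub ha he)
      (fun b hb e he => apply_eq_zero_of_mem_support_kirchhoffQuot hb he)
      (fun e he => by rw [sum_single_apply, if_neg fun h => he (Finset.mem_sdiff.1 h).1])
      (fun e he => by rw [sum_single_apply, if_neg fun h => (Finset.mem_compl.1 (Finset.mem_sdiff.1 h).1) he]),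
    hq, mul_zero, sqMomentum_rootSide_eq_zero_of_not_contract_indep hP hcons ha hS hcard hdep,
    sum_cutEdges_eq_zero_of_not_contract_indep hmass hcard hdep, neg_zero, add_zero]

/-- **(C3, IR) The mass monomial `x_e x^{𝟙_{E∖T}}` with `|T ∩ γ| = rk γ`, `e ∈ γ ∖ T` has coefficient `m_e²` on both sides.**
[cite: Brown2017, Thm 2.7 (proof of (XiIRfact): the term (Σ_{e∈E_G} m_e² α_e) R^Ψ and the masses of γ)] -/
theorem coeff_tree_add_single_eq_coeff_sub_mul (hconn : IsConnectedEdgeList E) (P : Matrix (Fin (V + 1)) (Fin (V + 1)) ℝ)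
    (m : Fin N → ℝ) (a : Fin (V + 1)) {γ T : Finset (Fin N)} (hT : IsSpanningTree E T) (hcard : (T ∩ γ).card = edgeRank E γ)
    {e : Fin N} (heγ : e ∈ γ) (heT : e ∉ T) :
    coeff (∑ e' ∈ Tᶜ, Finsupp.single e' 1 + Finsupp.single e 1) (gramSecondSymanzik E P m) =
      coeff (∑ e' ∈ Tᶜ, Finsupp.single e' 1 + Finsupp.single e 1) (gramSecondSymanzikSub E γ P m a * kirchhoffQuot E γ) := by
  classical
  have hTind : edgeRank E T = T.card := hT.2.trans hT.1.symm
  have hB := isBasis_inter_of_card_eq hTind hcard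
  have hbase : ((cycleMatroid E) ／ (↑γ : Set (Fin N))).IsBase (↑(T \ γ) : Set (Fin N)) := by
    rw [contract_isBase_iff_of_isBasis E hB Finset.sdiff_disjoint, Finset.sdiff_union_inter,
      isBase_cycleMatroid_iff_isSpanningTree E hconn]
    exact hT
  rw [coeff_gramSecondSymanzik_tree_add_single hconn P m hT heT, sum_single_compl_eq_add T γ, add_right_comm,
    coeff_add_mul_of_separated (fun a ha e he => apply_eq_zero_of_mem_support_gramSecondSymanzikSub ha he)
      (fun b hb e he => apply_eq_zero_of_mem_support_kirchhoffQuot hb he)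
      (fun x hx => by
        rw [Finsupp.add_apply, sum_single_apply, if_neg fun h => hx (Finset.mem_sdiff.1 h).1, Finsupp.single_apply,
          if_neg fun h => hx (by rw [← h]; exact heγ), add_zero])
      (fun x hx => by rw [sum_single_apply, if_neg fun h => (Finset.mem_compl.1 (Finset.mem_sdiff.1 h).1) hx]),
    coeff_gramSecondSymanzikSub_basis_add_single γ P m a Finset.inter_subset_right hB heγ
      (fun h => heT (Finset.mem_inter.1 h).1),
    coeff_kirchhoffQuot_base (fun x hx => Finset.mem_compl.2 (Finset.mem_sdiff.1 hx).2) hbase, mul_one]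

/-- **(C4, IR) The mass monomial `x_e x^{𝟙_{E∖T}}` with `|T ∩ γ| = rk γ − 1`, `e ∉ γ ∪ T` has coefficient `0` on both sides** (`m_e = 0`
outside the mass-spanning `γ`; `Ψ_{G/γ}` has only square-free monomials). [cite: Brown2017, Thm 2.7 (proof of (XiIRfact): "use the condition m_e ≠ 0 ⇒ e ∈ E_γ")] -/
theorem coeff_tree_add_single_eq_coeff_sub_mul_of_notMem (hconn : IsConnectedEdgeList E) (P : Matrix (Fin (V + 1)) (Fin (V + 1)) ℝ)
    {m : Fin N → ℝ} (a : Fin (V + 1)) {γ T : Finset (Fin N)} (hmass : ∀ e, m e ≠ 0 → e ∈ γ) (hT : IsSpanningTree E T)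
    {e : Fin N} (heγ : e ∉ γ) (heT : e ∉ T) :
    coeff (∑ e' ∈ Tᶜ, Finsupp.single e' 1 + Finsupp.single e 1) (gramSecondSymanzik E P m) =
      coeff (∑ e' ∈ Tᶜ, Finsupp.single e' 1 + Finsupp.single e 1) (gramSecondSymanzikSub E γ P m a * kirchhoffQuot E γ) := by
  classical
  have hme : m e = 0 := by
    by_contra h
    exact heγ (hmass e h)
  have hq : coeff (∑ e' ∈ γᶜ \ (T \ γ), Finsupp.single e' (1 : ℕ) + Finsupp.single e 1) (kirchhoffQuot E γ) = 0 := by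
    by_contra h
    obtain ⟨B', hB'γ, -, heq⟩ := exists_of_coeff_kirchhoffQuot_ne_zero h
    exact sdiff_ne_sdiff_add_single (Finset.mem_compl.2 heγ) (fun h => heT (Finset.mem_sdiff.1 h).1) heq.symm
  rw [coeff_gramSecondSymanzik_tree_add_single hconn P m hT heT, hme, sum_single_compl_eq_add T γ, add_assoc,
    coeff_add_mul_of_separated (fun a ha e he => apply_eq_zero_of_mem_support_gramSecondSymanzikSub ha he)
      (fun b hb e he => apply_eq_zero_of_mem_support_kirchhoffQuot hb he)
      (fun x hx => by rw [sum_single_apply, if_neg fun h => hx (Finset.mem_sdiff.1 h).1])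
      (fun x hx => by
        rw [Finsupp.add_apply, sum_single_apply, if_neg fun h => (Finset.mem_compl.1 (Finset.mem_sdiff.1 h).1) hx,
          Finsupp.single_apply, if_neg fun h => heγ (by rw [h]; exact hx), add_zero]),
    hq, mul_zero]
  ring

/-- **The `(L_γ+1)`-homogeneous part of `ℱ_G(𝒫)` in the variables of a MASS-MOMENTUM SPANNING `γ` IS `ℱ_γ(𝒫) · Ψ_{G/γ}`, coefficient by
coefficient** — for every symmetric conserved `𝒫` on a connected edge list, `γ` containing every massive edge and joining all
external vertices, `a` a vertex reaching them inside `γ`: at every exponent with exactly `L_γ + 1` variables of `γ`, `[x^d] ℱ_G(𝒫) =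
[x^d] (ℱ_γ(𝒫) Ψ_{G/γ})`. [cite: Brown2017, Prop. 2.4 and Thm 2.7 eq. (XiIRfact) ("Ξ_G(q,m) = Ξ_γ(q,m) Ψ_{G/γ} + R^{Ξ,IR}_{γ,G}(q,m) where R^{Ξ,IR} has degree > h_γ+1 in the α_e, e ∈ E_γ"); Schultka2018, Proposition 4.11 (1),(4),(5)] -/
theorem coeff_eq_coeff_sub_mul_of_gammaDeg_eq (hconn : IsConnectedEdgeList E) (hP : P.IsSymm) (hcons : ∀ u, ∑ v, P u v = 0)
    {m : Fin N → ℝ} {γ : Finset (Fin N)} (hmm : IsMassMomentumSpanningGram E P m γ) {a : Fin (V + 1)}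
    (ha : ∀ v, IsExternal P v → (edgeGraph E γ).Reachable a v) {d : Fin N →₀ ℕ} (hdeg : ∑ e ∈ γ, d e = loopNumber E γ + 1) :
    coeff d (gramSecondSymanzik E P m) = coeff d (gramSecondSymanzikSub E γ P m a * kirchhoffQuot E γ) := by
  classical
  have hrk := edgeRank_le_card E γ
  have hmass : ∀ e, m e ≠ 0 → e ∈ γ := hmm.1
  -- the 2-forest case, used several times
  have hα : ∀ S, IsSpanningTwoForest E S → (S ∩ γ).card + 1 = edgeRank E γ →
      coeff (∑ e' ∈ Sᶜ, Finsupp.single e' 1) (gramSecondSymanzik E P m) =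
        coeff (∑ e' ∈ Sᶜ, Finsupp.single e' 1) (gramSecondSymanzikSub E γ P m a * kirchhoffQuot E γ) := fun S hS hcard => by
    by_cases hind : ((cycleMatroid E) ／ (γ : Set (Fin N))).Indep ((S \ γ : Finset (Fin N)) : Set (Fin N))
    · exact coeff_twoForest_eq_coeff_sub_mul_of_indep hconn hP hcons hmass ha hS hcard hind
    · exact coeff_twoForest_eq_coeff_sub_mul_of_not_indep hP hcons hmass ha hS hcard hind
  by_cases hG : coeff d (gramSecondSymanzik E P m) = 0
  · by_cases hQ : coeff d (gramSecondSymanzikSub E γ P m a * kirchhoffQuot E γ) = 0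
    · rw [hG, hQ]
    · exfalso
      set a' := d.filter (· ∈ γ) with ha'
      set b := d.filter (fun e => ¬ e ∈ γ) with hb
      have hab : a' + b = d := Finsupp.filter_add_filter_not d (· ∈ γ)
      have ha0 : ∀ e ∉ γ, a' e = 0 := fun e he => Finsupp.filter_apply_neg (· ∈ γ) d he
      have hb0 : ∀ e ∈ γ, b e = 0 := fun e he => Finsupp.filter_apply_neg (fun e => ¬ e ∈ γ) d (not_not.2 he)
      have hQ' := hQ
      rw [← hab, coeff_add_mul_of_separated (fun a ha e he => apply_eq_zero_of_mem_support_gramSecondSymanzikSub ha he)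
          (fun b hb e he => apply_eq_zero_of_mem_support_kirchhoffQuot hb he) ha0 hb0] at hQ'
      have hQa : coeff a' (gramSecondSymanzikSub E γ P m a) ≠ 0 := fun h => hQ' (by rw [h, zero_mul])
      have hQb : coeff b (kirchhoffQuot E γ) ≠ 0 := fun h => hQ' (by rw [h, mul_zero])
      obtain ⟨B', hB'γ, hB', hB'b⟩ := exists_of_coeff_kirchhoffQuot_ne_zero hQb
      have key : coeff d (gramSecondSymanzik E P m) = coeff d (gramSecondSymanzikSub E γ P m a * kirchhoffQuot E γ) := by
        rcases exists_of_coeff_gramSecondSymanzikSub_ne_zero hQa with ⟨F', hF'γ, hF', hF'a⟩ | ⟨B, hBγ, hB, e, he, hea⟩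
        · -- `d = 𝟙_{E∖(F' ∪ B')}`: a class-`C_1` 2-forest monomial
          obtain ⟨hS, hSγ, hSγ'⟩ := isSpanningTwoForest_union_of_sub hconn hF'γ hF' hB'γ hB'
          have hd : d = ∑ e' ∈ (F' ∪ B')ᶜ, Finsupp.single e' 1 := by
            rw [← hab, hF'a, hB'b, sum_single_compl_eq_add (F' ∪ B') γ, hSγ, hSγ']
          rw [hd]
          exact hα _ hS (by rw [hSγ]; exact hF'.2)
        · obtain ⟨hT, hTγ, hTγ'⟩ := isSpanningTree_union hconn hBγ hB hB'γ hB'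
          have hcardB : B.card = edgeRank E γ := ((isBasis_cycleMatroid_iff E B γ).1 hB).2.2
          by_cases heB : e ∈ B
          · -- `d = 𝟙_{E∖(T − e)}` with `T − e` a 2-forest meeting `γ` in `B − e`
            have heT : e ∈ B ∪ B' := Finset.mem_union_left B' heB
            have hF := hT.isSpanningTwoForest_erase heT
            have hd : d = ∑ e' ∈ ((B ∪ B').erase e)ᶜ, Finsupp.single e' 1 := by
              rw [← sum_single_compl_add_single_of_mem heT, ← hab, hea, hB'b, add_right_comm,
                sum_single_compl_eq_add (B ∪ B') γ, hTγ, hTγ']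
            rw [hd]
            refine hα _ hF ?_
            rw [Finset.erase_inter, hTγ, Finset.card_erase_of_mem heB, hcardB]
            have : 1 ≤ B.card := Finset.card_pos.2 ⟨e, heB⟩
            omega
          · -- `d = x_e x^{𝟙_{E∖T}}`, `e ∈ γ ∖ T`: C3
            have heT : e ∉ B ∪ B' := fun h => (Finset.mem_union.1 h).elim heB fun h' => (Finset.mem_compl.1 (hB'γ h')) he
            have hd : d = ∑ e' ∈ (B ∪ B')ᶜ, Finsupp.single e' 1 + Finsupp.single e 1 := by
              rw [← hab, hea, hB'b, add_right_comm, sum_single_compl_eq_add (B ∪ B') γ, hTγ, hTγ']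
            rw [hd]
            exact coeff_tree_add_single_eq_coeff_sub_mul hconn P m a hT (by rw [hTγ, hcardB]) he heT
      exact hQ (by rw [← key, hG])
  · have hd' := support_gramSecondSymanzik_subset hP hcons m (mem_support_iff.2 hG)
    rcases exists_of_mem_support_secondSymanzikPolynomial hd' with ⟨S, hS, -, rfl⟩ | ⟨T, e, hT, -, rfl⟩
    · rw [gammaDeg_compl, loopNumber] at hdeg
      have hle := card_inter_le_edgeRank hS.2 γ
      have hsum := Finset.card_sdiff_add_card_inter γ S
      rw [Finset.inter_comm] at hsum
      exact hα S hS (by omega)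
    · by_cases heT : e ∈ T
      · rw [sum_single_compl_add_single_of_mem heT] at hdeg ⊢
        have hF := hT.isSpanningTwoForest_erase heT
        rw [gammaDeg_compl, loopNumber] at hdeg
        have hle := card_inter_le_edgeRank hF.2 γ
        have hsum := Finset.card_sdiff_add_card_inter γ (T.erase e)
        rw [Finset.inter_comm] at hsum
        exact hα _ hF (by omega)
      · rw [gammaDeg_compl_add_single, loopNumber] at hdeg
        have hTind : edgeRank E T = T.card := hT.2.trans hT.1.symm
        have hle := card_inter_le_edgeRank hTind γ
        have hsum := Finset.card_sdiff_add_card_inter γ T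
        rw [Finset.inter_comm] at hsum
        by_cases heγ : e ∈ γ
        · rw [if_pos heγ] at hdeg
          exact coeff_tree_add_single_eq_coeff_sub_mul hconn P m a hT (by omega) heγ heT
        · rw [if_neg heγ, add_zero] at hdeg
          exact coeff_tree_add_single_eq_coeff_sub_mul_of_notMem hconn P a hmass hT heγ heT

end Leading

/-! ## Part 5 — PROP. 2.4 / THM 2.7 (IR LINE) FOR `𝒫`: `ℱ_G(𝒫) = ℱ_γ(𝒫) Ψ_{G/γ} + R`, `deg_γ R ≥ L_γ + 2`; the IR face is the product face -/

section IRFace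

variable {P : Matrix (Fin (V + 1)) (Fin (V + 1)) ℝ}

/-- **THEOREM 2.7, IR line (= Prop. 2.4 with masses), for Gram-matrix kinematics in EVERY regime**: "Now suppose that γ is a
mass-momentum subgraph. In this case, Ξ_G(q,m) = Ξ_γ(q,m) Ψ_{G/γ} + R^{Ξ,IR}_{γ,G}(q,m) where R^{Ξ,IR}_{γ,G}(q,m) has degree > h_γ+1 in
the α_e, e ∈ E_γ" — for `ℱ_G(𝒫)` from ANY symmetric `𝒫` with vanishing row sums (no genericity) and real masses on a connected
edge list, `γ` mass-momentum spanning in the combinatorial sense (all massive edges in `γ`, all external vertices joined by `γ`), `a`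
reaching the external vertices inside `γ`: every monomial of `ℱ_G(𝒫) − ℱ_γ(𝒫) · Ψ_{G/γ}` has at least `L_γ + 2` variables of `γ`.
[cite: Brown2017, Prop. 2.4 / Thm 2.7 eq. (XiIRfact) (arXiv:1512.06409 §2.2–2.3); Schultka2018, Proposition 4.11 (1) (toricfeynman.tex l.2246–2255)] -/
theorem le_gammaDeg_of_mem_support_ir_remainder_gram (hconn : IsConnectedEdgeList E) (hP : P.IsSymm)
    (hcons : ∀ u, ∑ v, P u v = 0) {m : Fin N → ℝ} {γ : Finset (Fin N)} (hmm : IsMassMomentumSpanningGram E P m γ)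
    {a : Fin (V + 1)} (ha : ∀ v, IsExternal P v → (edgeGraph E γ).Reachable a v) {d : Fin N →₀ ℕ}
    (hd : d ∈ (gramSecondSymanzik E P m - gramSecondSymanzikSub E γ P m a * kirchhoffQuot E γ).support) :
    loopNumber E γ + 2 ≤ ∑ e ∈ γ, d e := by
  classical
  have hne : coeff d (gramSecondSymanzik E P m) ≠ coeff d (gramSecondSymanzikSub E γ P m a * kirchhoffQuot E γ) := by
    intro h
    rw [mem_support_iff, coeff_sub, h, sub_self] at hd
    exact hd rfl
  have hdeg : ∑ e ∈ γ, d e ≠ loopNumber E γ + 1 := fun h => hne (coeff_eq_coeff_sub_mul_of_gammaDeg_eq hconn hP hcons hmm ha h)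
  rcases Finset.mem_union.1 (MvPolynomial.support_sub (Fin N) _ _ hd) with h | h
  · have := loopNumber_add_one_le_gammaDeg_of_quot_eq_zero hconn hP hcons m
      (gramSecondSymanzikQuot_eq_zero_of_isMassMomentumSpanningGram hP hcons hmm) h
    omega
  · exact absurd (gammaDeg_of_mem_support_sub_mul_quot h) hdeg

/-- **The initial form of `ℱ_G(𝒫)` on the IR face `−1_γ` of a mass-momentum spanning `γ` is the PRODUCT `ℱ_γ(𝒫) · Ψ_{G/γ}`**
(Borinsky's truncation, face value `−(L_γ + 1)`; Schultka Cor. 4.12's product face on the IR side; Borinsky's proof of Theorem 32: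
the branch `z_Φ(γ) = ℓ(γ) + 1`), whenever `ℱ_γ(𝒫) ≠ 0` — every symmetric conserved `𝒫`, real masses, connected edge list.
[cite: Brown2017, Thm 2.7 eq. (XiIRfact); Schultka2018, Corollary 4.12; Borinsky2020, Definition 1 and Theorem 32 (proof, tropical.tex l.1217); BorinskyMunchTellander2023, Theorem 3.5 (main.tex l.740–746)] -/
theorem faceValue_and_trunc_gramSecondSymanzik_neg_setIndicator_of_mm (hconn : IsConnectedEdgeList E) (hP : P.IsSymm)
    (hcons : ∀ u, ∑ v, P u v = 0) {m : Fin N → ℝ} {γ : Finset (Fin N)} (hmm : IsMassMomentumSpanningGram E P m γ)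
    {a : Fin (V + 1)} (ha : ∀ v, IsExternal P v → (edgeGraph E γ).Reachable a v) (hsub : gramSecondSymanzikSub E γ P m a ≠ 0) :
    faceValue (gramSecondSymanzik E P m) (-setIndicator γ) = -((loopNumber E γ + 1 : ℕ) : ℝ) ∧
      trunc (gramSecondSymanzik E P m) (-setIndicator γ) = gramSecondSymanzikSub E γ P m a * kirchhoffQuot E γ := by
  refine faceValue_eq_and_trunc_eq_of_eq_add
    (r := gramSecondSymanzik E P m - gramSecondSymanzikSub E γ P m a * kirchhoffQuot E γ)
    (add_sub_cancel _ _).symm (mul_ne_zero hsub (kirchhoffQuot_ne_zero E γ)) (fun d hd => ?_) (fun d hd => ?_)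
  · rw [pairing_neg_setIndicator, gammaDeg_of_mem_support_sub_mul_quot hd]
  · rw [pairing_neg_setIndicator, neg_lt_neg_iff]
    exact_mod_cast Nat.lt_of_succ_le (le_gammaDeg_of_mem_support_ir_remainder_gram hconn hP hcons hmm ha hd)

end IRFace

end Literature.MathematicalPhysics.QuantumFieldTheory.BorinskyMunchTellander2023
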